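import Summits.RiemannHypothesis.RiemannHypothesis.Theorems.WeilGroundStateGroundStatesConvergeToXiStubZeroSideEnergy
import Summits.RiemannHypothesis.RiemannHypothesis.Theorems.WeilGroundStateGroundStatesConvergeToXiStubSamplingCauchy
import Summits.RiemannHypothesis.RiemannHypothesis.Theorems.WeilGroundStateGroundStatesConvergeToXiStubFormBoundedSampling
import Summits.RiemannHypothesis.RiemannHypothesis.Theorems.WeilGroundStateGroundStatesConvergeToXiStubLogWeightedAssembly
import Summits.RiemannHypothesis.RiemannHypothesis.Theorems.WeilGroundStateGroundStatesConvergeToXiStubWeightedLineBudget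
import Summits.RiemannHypothesis.RiemannHypothesis.Theorems.WeilGroundStateGroundStatesConvergeToXiStubLogPlancherel
import Summits.RiemannHypothesis.RiemannHypothesis.Theorems.WeilGroundStateGroundStatesConvergeToXiRealNormalForm
import Summits.RiemannHypothesis.RiemannHypothesis.Theorems.WeilGroundStateGroundStatesConvergeToXiRenormBlowup
import Summits.RiemannHypothesis.RiemannHypothesis.Theorems.WeilGroundStateGroundStatesConvergeToXiEnergyBddBelow
import Literature.NumberTheory.LFunctions.WeilGroundEnergyParitySplit
import Literature.NumberTheory.LFunctions.WeilArchimedeanMoments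
import HarnessLib

/-!
# `WeilGroundState.GroundStatesConvergeToXi` — the RH-free zero-side DEFECT identity of a Weil
ground state and the zero-side tightness criterion (crux item stmt-RiemannHypothesis-1527, route
route-RiemannHypothesis-WeilGroundState; line `Sketch`, lead c7; `--supports`)

Composition of the rev-L9c stubs (all landed) and their first consequences, RH-free throughout:

* `formBoundedSampling_holds`, `samplingCauchy_holds`, `hasSum_zeroSideEnergy`,
  `summable_order_mul_norm_sq_weilMellin` — the wave-2 chain composed by name: the zero-sampling
  map is form-bounded on every window; for EVERY ground state `u` at EVERY window `a`,
  `(û(ρ))_ρ ∈ ℓ²(m)` and **`Σ_ρ m(ρ) û(ρ) conj û(1-ρ̄) = ε(a)`** (explicit formula at the ground state).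
* `tsum_order_mul_norm_sq_sub_reflect_eq` — **the defect identity**:
  `Σ_ρ m(ρ)‖û(ρ) − û(1−ρ̄)‖² = 2 Σ_ρ m(ρ)‖û(ρ)‖² − 2 ε(a)`: the sampling energy exceeds the
  ground energy by exactly half the asymmetry of the samples under `ρ ↦ 1 − ρ̄` (zero under RH).
* Real even ground states (the crux's normal form, `groundStatesConvergeToXi_iff_real_even_pos`):
  `conj û(1−ρ̄) = û(ρ)`, so **`Σ_ρ m(ρ) û(ρ)² = ε(a)`** (complex squares; `hasSum_order_mul_weilMellin_sq`),
  **`ε(a) = Σ_ρ m[(Re û(ρ))² − (Im û(ρ))²]`** and **`Σ_ρ m‖û(ρ)‖² = ε(a) + 2 Σ_ρ m (Im û(ρ))²`**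
  (`tsum_order_mul_norm_sq_eq_add_im_sq`): the whole gap between sampling energy and ground
  energy is the IMAGINARY part of the samples, which vanishes on the critical line
  (`im_weilMellin_criticalLine_eq_zero`) — it lives at off-line zeros only.
* `riemannHypothesis_of_realEvenCruxWitness_zeroSideTight` — **the zero-side twin of the
  tightness criterion**: a real even crux witness (`c_k > 0`, `c_k û_k → ξ` locally uniformly on
  the strip) whose renormalised zero samples `(c_k û_k(ρ))_ρ` are ℓ²(m)-TIGHT (uniformly small
  outside a finite set of zeros) proves RH: `c_k² ε(a_k) = Σ_ρ m (c_k û_k(ρ))² → Σ_ρ m ξ(ρ)² = 0`,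
  and under `¬RH` `‖c_k‖ → ∞` (c3), so `ε(a_k) → 0`, `ε ≥ -1` on `(0,∞)` by antitonicity, hence RH
  (`riemannHypothesis_of_weilGroundEnergy_bddBelow`) — contradiction.

No new definitions; Mathlib + landed tree files only.
-/

set_option linter.dupNamespace false

noncomputable section

open MeasureTheory Complex Filter Set
open scoped Real Topology ComplexConjugate

namespace Summit.RiemannHypothesis.RiemannHypothesis.Theorems.GroundStatesConvergeToXi

open Literature.NumberTheory.LFunctions

/-! ### The wave-2 chain composed by name -/

/-- **Form-bounded zero sampling (RH-free)**: for every window `a > 0` there are `A, B ≥ 0` with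
`Σ_ρ m(ρ)‖ĝ(ρ)‖² ≤ A·Re Q(g) + B·‖g‖₂²`, summably, for every test function `g` supported in
`[-a, a]` (`stub_formBoundedSampling ∘ stub_logWeightedAssembly, stub_weightedLineBudget ∘ stub_logPlancherel`). [folklore] -/
theorem formBoundedSampling_holds :
    ∀ a : ℝ, 0 < a → ∃ A B : ℝ, 0 ≤ A ∧ 0 ≤ B ∧ ∀ g : ℝ → ℂ, IsWeilTest g →
      tsupport g ⊆ Icc (-a) a →
        Summable (fun ρ : ZetaZeros.riemannZetaNontrivialZeros =>
          (riemannZetaZeroOrder (ρ : ℂ) : ℝ) * ‖weilMellin g ρ‖ ^ 2) ∧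
        ∑' ρ : ZetaZeros.riemannZetaNontrivialZeros,
            (riemannZetaZeroOrder (ρ : ℂ) : ℝ) * ‖weilMellin g ρ‖ ^ 2 ≤
          A * (weilQuadratic g).re + B * ∫ t : ℝ, ‖g t‖ ^ 2 :=
  stub_formBoundedSampling stub_logWeightedAssembly (stub_weightedLineBudget stub_logPlancherel)

/-- **ℓ²(m)-convergence of the zero samples along a minimising sequence (RH-free)**
(`stub_samplingCauchy ∘ formBoundedSampling_holds`). [folklore] -/
theorem samplingCauchy_holds {a : ℝ} {u : ℝ → ℂ} {g : ℕ → ℝ → ℂ} (hu : IsWeilGroundState a u)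
    (hg : ∀ n, IsWeilTest (g n) ∧ tsupport (g n) ⊆ Icc (-a) a ∧ ∫ t, ‖g n t‖ ^ 2 = (1 : ℝ))
    (hQ : Tendsto (fun n => (weilQuadratic (g n)).re) atTop (𝓝 (weilGroundEnergy a)))
    (hL : Tendsto (fun n => ∫ t, ‖g n t - u t‖ ^ 2) atTop (𝓝 0)) :
    Summable (fun ρ : ZetaZeros.riemannZetaNontrivialZeros =>
        (riemannZetaZeroOrder (ρ : ℂ) : ℝ) * ‖weilMellin u ρ‖ ^ 2) ∧
      (∀ n, Summable (fun ρ : ZetaZeros.riemannZetaNontrivialZeros =>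
        (riemannZetaZeroOrder (ρ : ℂ) : ℝ) * ‖weilMellin (g n) ρ - weilMellin u ρ‖ ^ 2)) ∧
      Tendsto (fun n => ∑' ρ : ZetaZeros.riemannZetaNontrivialZeros,
        (riemannZetaZeroOrder (ρ : ℂ) : ℝ) * ‖weilMellin (g n) ρ - weilMellin u ρ‖ ^ 2)
        atTop (𝓝 0) :=
  stub_samplingCauchy formBoundedSampling_holds a u g hu hg hQ hL

/-- **The RH-free zero-side energy identity**: for every ground state `u` at the window `a`,
`Σ_ρ m(ρ) û(ρ) conj û(1 − ρ̄) = ε(a)`, absolutely convergent (`stub_zeroSideEnergy ∘ stub_samplingCauchy`). [folklore] -/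
theorem hasSum_zeroSideEnergy {a : ℝ} {u : ℝ → ℂ} (hu : IsWeilGroundState a u) :
    HasSum (fun ρ : ZetaZeros.riemannZetaNontrivialZeros =>
        (riemannZetaZeroOrder (ρ : ℂ) : ℂ) *
          (weilMellin u ρ * conj (weilMellin u (1 - conj (ρ : ℂ)))))
      ((weilGroundEnergy a : ℝ) : ℂ) :=
  stub_zeroSideEnergy (stub_samplingCauchy formBoundedSampling_holds) a u hu

/-- **Log-free square-summability of the zero samples of a ground state (RH-free)**:
`Σ_ρ m(ρ)‖û(ρ)‖² < ∞`. [folklore] -/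
theorem summable_order_mul_norm_sq_weilMellin {a : ℝ} {u : ℝ → ℂ} (hu : IsWeilGroundState a u) :
    Summable (fun ρ : ZetaZeros.riemannZetaNontrivialZeros =>
      (riemannZetaZeroOrder (ρ : ℂ) : ℝ) * ‖weilMellin u ρ‖ ^ 2) := by
  obtain ⟨hmem, g, hg, hQ, hL⟩ := hu
  exact (samplingCauchy_holds ⟨hmem, g, hg, hQ, hL⟩ hg hQ hL).1

/-! ### The defect identity -/

/-- Real part of the weighted term: `Re (m · z) = m · Re z` for the integer weight `m`. [folklore] -/
theorem zeroSideDefect_re_intCast_mul (m : ℤ) (z : ℂ) : ((m : ℂ) * z).re = (m : ℝ) * z.re := by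
  simp [Complex.mul_re]

/-- **The RH-free DEFECT IDENTITY of a Weil ground state.**  For every ground state `u` at the
window `a`, the reflected differences of the zero samples are square-summable and
`Σ_ρ m(ρ)‖û(ρ) − û(1 − ρ̄)‖² = 2 Σ_ρ m(ρ)‖û(ρ)‖² − 2 ε(a)`:
expand `‖x − y‖² = ‖x‖² + ‖y‖² − 2Re(x ȳ)`, reindex the middle sum by the `m`-preserving
involution `ρ ↦ 1 − ρ̄` (`zeroSideEnergy_reindex`) and insert the zero-side energy identity. [folklore] -/
theorem tsum_order_mul_norm_sq_sub_reflect_eq {a : ℝ} {u : ℝ → ℂ} (hu : IsWeilGroundState a u) :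
    Summable (fun ρ : ZetaZeros.riemannZetaNontrivialZeros =>
        (riemannZetaZeroOrder (ρ : ℂ) : ℝ) *
          ‖weilMellin u ρ - weilMellin u (1 - conj (ρ : ℂ))‖ ^ 2) ∧
    ∑' ρ : ZetaZeros.riemannZetaNontrivialZeros,
        (riemannZetaZeroOrder (ρ : ℂ) : ℝ) * ‖weilMellin u ρ - weilMellin u (1 - conj (ρ : ℂ))‖ ^ 2 =
      2 * ∑' ρ : ZetaZeros.riemannZetaNontrivialZeros,
          (riemannZetaZeroOrder (ρ : ℂ) : ℝ) * ‖weilMellin u ρ‖ ^ 2 - 2 * weilGroundEnergy a := by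
  set F : ℂ → ℂ := weilMellin u with hF
  -- the three summable pieces
  have hS : Summable (fun ρ : ZetaZeros.riemannZetaNontrivialZeros =>
      (riemannZetaZeroOrder (ρ : ℂ) : ℝ) * ‖F ρ‖ ^ 2) := summable_order_mul_norm_sq_weilMellin hu
  have hR := zeroSideEnergy_reindex (fun z : ℂ => ‖F z‖ ^ 2)
  have hS' : Summable (fun ρ : ZetaZeros.riemannZetaNontrivialZeros =>
      (riemannZetaZeroOrder (ρ : ℂ) : ℝ) * ‖F (1 - conj (ρ : ℂ))‖ ^ 2) := hR.1.2 hS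
  have hT' : ∑' ρ : ZetaZeros.riemannZetaNontrivialZeros,
      (riemannZetaZeroOrder (ρ : ℂ) : ℝ) * ‖F (1 - conj (ρ : ℂ))‖ ^ 2 =
        ∑' ρ : ZetaZeros.riemannZetaNontrivialZeros, (riemannZetaZeroOrder (ρ : ℂ) : ℝ) * ‖F ρ‖ ^ 2 :=
    hR.2
  have hE' : HasSum (fun ρ : ZetaZeros.riemannZetaNontrivialZeros =>
      (riemannZetaZeroOrder (ρ : ℂ) : ℝ) * (F ρ * conj (F (1 - conj (ρ : ℂ)))).re)
      (weilGroundEnergy a) := by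
    have hE := Complex.hasSum_re (hasSum_zeroSideEnergy hu)
    rw [Complex.ofReal_re] at hE
    exact hE.congr_fun fun ρ => (zeroSideDefect_re_intCast_mul _ _).symm
  -- pointwise expansion
  have hpt : ∀ ρ : ZetaZeros.riemannZetaNontrivialZeros,
      (riemannZetaZeroOrder (ρ : ℂ) : ℝ) * ‖F ρ - F (1 - conj (ρ : ℂ))‖ ^ 2 =
        (riemannZetaZeroOrder (ρ : ℂ) : ℝ) * ‖F ρ‖ ^ 2 +
          (riemannZetaZeroOrder (ρ : ℂ) : ℝ) * ‖F (1 - conj (ρ : ℂ))‖ ^ 2 -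
          2 * ((riemannZetaZeroOrder (ρ : ℂ) : ℝ) * (F ρ * conj (F (1 - conj (ρ : ℂ)))).re) := by
    intro ρ
    rw [norm_sub_sq_complex]
    ring
  have hsum : Summable (fun ρ : ZetaZeros.riemannZetaNontrivialZeros =>
      (riemannZetaZeroOrder (ρ : ℂ) : ℝ) * ‖F ρ - F (1 - conj (ρ : ℂ))‖ ^ 2) := by
    have h := (hS.add hS').sub (hE'.summable.mul_left 2)
    refine h.congr fun ρ => ?_
    exact (hpt ρ).symm
  refine ⟨hsum, ?_⟩
  calc ∑' ρ : ZetaZeros.riemannZetaNontrivialZeros,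
        (riemannZetaZeroOrder (ρ : ℂ) : ℝ) * ‖F ρ - F (1 - conj (ρ : ℂ))‖ ^ 2
      = ∑' ρ : ZetaZeros.riemannZetaNontrivialZeros,
          ((riemannZetaZeroOrder (ρ : ℂ) : ℝ) * ‖F ρ‖ ^ 2 +
            (riemannZetaZeroOrder (ρ : ℂ) : ℝ) * ‖F (1 - conj (ρ : ℂ))‖ ^ 2 -
            2 * ((riemannZetaZeroOrder (ρ : ℂ) : ℝ) * (F ρ * conj (F (1 - conj (ρ : ℂ)))).re)) :=
        tsum_congr hpt
    _ = (∑' ρ : ZetaZeros.riemannZetaNontrivialZeros, (riemannZetaZeroOrder (ρ : ℂ) : ℝ) * ‖F ρ‖ ^ 2) +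
          (∑' ρ : ZetaZeros.riemannZetaNontrivialZeros,
            (riemannZetaZeroOrder (ρ : ℂ) : ℝ) * ‖F (1 - conj (ρ : ℂ))‖ ^ 2) -
          ∑' ρ : ZetaZeros.riemannZetaNontrivialZeros,
            2 * ((riemannZetaZeroOrder (ρ : ℂ) : ℝ) * (F ρ * conj (F (1 - conj (ρ : ℂ)))).re) := by
        rw [(hS.add hS').tsum_sub (hE'.summable.mul_left 2), hS.tsum_add hS']
    _ = 2 * ∑' ρ : ZetaZeros.riemannZetaNontrivialZeros,
          (riemannZetaZeroOrder (ρ : ℂ) : ℝ) * ‖F ρ‖ ^ 2 - 2 * weilGroundEnergy a := by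
        rw [hT', tsum_mul_left, hE'.tsum_eq]
        ring

/-- **Sampling energy vs. ground energy (RH-free)**: `ε(a) ≤ Σ_ρ m(ρ)‖û(ρ)‖²` for every ground
state — with equality iff the samples are symmetric under `ρ ↦ 1 − ρ̄` (the defect identity). [folklore] -/
theorem weilGroundEnergy_le_tsum_order_mul_norm_sq {a : ℝ} {u : ℝ → ℂ} (hu : IsWeilGroundState a u) :
    weilGroundEnergy a ≤ ∑' ρ : ZetaZeros.riemannZetaNontrivialZeros,
      (riemannZetaZeroOrder (ρ : ℂ) : ℝ) * ‖weilMellin u ρ‖ ^ 2 := by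
  obtain ⟨hsum, heq⟩ := tsum_order_mul_norm_sq_sub_reflect_eq hu
  have hnn : 0 ≤ ∑' ρ : ZetaZeros.riemannZetaNontrivialZeros,
      (riemannZetaZeroOrder (ρ : ℂ) : ℝ) * ‖weilMellin u ρ - weilMellin u (1 - conj (ρ : ℂ))‖ ^ 2 :=
    tsum_nonneg fun ρ => mul_nonneg
      (by exact_mod_cast riemannZetaZeroOrder_nonneg (ZetaZeros.riemannZetaNontrivialZeros.ne_one ρ.2))
      (sq_nonneg _)
  have _ := hsum
  linarith

/-! ### Real even ground states: complex squares -/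

/-- For a REAL EVEN function, `conj û(1 − ρ̄) = û(ρ)` (`û(1 − s) = û(s)`, `û(conj s) = conj û(s)`). [folklore] -/
theorem conj_weilMellin_one_sub_conj_of_real_even {u : ℝ → ℂ} (hev : ∀ t, u (-t) = u t)
    (hre : ∀ t, (u t).im = 0) (s : ℂ) :
    conj (weilMellin u (1 - conj s)) = weilMellin u s := by
  rw [weilMellin_one_sub_of_even hev, weilMellin_conj_of_real hre, Complex.conj_conj]

/-- **Zero-side energy identity for REAL EVEN ground states (RH-free): `Σ_ρ m(ρ) û(ρ)² = ε(a)`**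
— complex squares, absolutely convergent; under RH every `û(ρ)` is real and this is the
saturation identity `Σ m|û(ρ)|² = ε(a)`. [folklore] -/
theorem hasSum_order_mul_weilMellin_sq {a : ℝ} {u : ℝ → ℂ} (hu : IsWeilGroundState a u)
    (hev : ∀ t, u (-t) = u t) (hre : ∀ t, (u t).im = 0) :
    HasSum (fun ρ : ZetaZeros.riemannZetaNontrivialZeros =>
        (riemannZetaZeroOrder (ρ : ℂ) : ℂ) * weilMellin u ρ ^ 2)
      ((weilGroundEnergy a : ℝ) : ℂ) := by
  refine (hasSum_zeroSideEnergy hu).congr_fun fun ρ => ?_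
  rw [conj_weilMellin_one_sub_conj_of_real_even hev hre, sq]

/-- **`ε(a) = Σ_ρ m(ρ)[(Re û(ρ))² − (Im û(ρ))²]`** for real even ground states: the ground energy
is the REAL sampling energy minus the IMAGINARY sampling energy (RH-free; the imaginary parts
vanish on the critical line, `im_weilMellin_criticalLine_eq_zero`). [folklore] -/
theorem hasSum_order_mul_re_sq_sub_im_sq {a : ℝ} {u : ℝ → ℂ} (hu : IsWeilGroundState a u)
    (hev : ∀ t, u (-t) = u t) (hre : ∀ t, (u t).im = 0) :
    HasSum (fun ρ : ZetaZeros.riemannZetaNontrivialZeros =>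
        (riemannZetaZeroOrder (ρ : ℂ) : ℝ) * ((weilMellin u ρ).re ^ 2 - (weilMellin u ρ).im ^ 2))
      (weilGroundEnergy a) := by
  have h := Complex.hasSum_re (hasSum_order_mul_weilMellin_sq hu hev hre)
  rw [Complex.ofReal_re] at h
  refine h.congr_fun fun ρ => ?_
  rw [zeroSideDefect_re_intCast_mul]
  congr 1
  have h2 : (weilMellin u ρ ^ 2).re = (weilMellin u ρ).re ^ 2 - (weilMellin u ρ).im ^ 2 := by
    rw [sq, Complex.mul_re]; ring
  rw [h2]

/-- **`Σ_ρ m(ρ)‖û(ρ)‖² = ε(a) + 2 Σ_ρ m(ρ)(Im û(ρ))²`** for real even ground states (RH-free):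
the imaginary sampling energy is summable and is exactly half the gap between sampling energy
and ground energy. [folklore] -/
theorem tsum_order_mul_norm_sq_eq_add_im_sq {a : ℝ} {u : ℝ → ℂ} (hu : IsWeilGroundState a u)
    (hev : ∀ t, u (-t) = u t) (hre : ∀ t, (u t).im = 0) :
    Summable (fun ρ : ZetaZeros.riemannZetaNontrivialZeros =>
        (riemannZetaZeroOrder (ρ : ℂ) : ℝ) * (weilMellin u ρ).im ^ 2) ∧
    ∑' ρ : ZetaZeros.riemannZetaNontrivialZeros,
        (riemannZetaZeroOrder (ρ : ℂ) : ℝ) * ‖weilMellin u ρ‖ ^ 2 =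
      weilGroundEnergy a +
        2 * ∑' ρ : ZetaZeros.riemannZetaNontrivialZeros,
          (riemannZetaZeroOrder (ρ : ℂ) : ℝ) * (weilMellin u ρ).im ^ 2 := by
  set F : ℂ → ℂ := weilMellin u with hF
  have hS : Summable (fun ρ : ZetaZeros.riemannZetaNontrivialZeros =>
      (riemannZetaZeroOrder (ρ : ℂ) : ℝ) * ‖F ρ‖ ^ 2) := summable_order_mul_norm_sq_weilMellin hu
  have hD := hasSum_order_mul_re_sq_sub_im_sq hu hev hre
  -- `‖z‖² = re² + im²`, so `m im² = (m‖z‖² − m(re² − im²))/2`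
  have hpt : ∀ ρ : ZetaZeros.riemannZetaNontrivialZeros,
      (riemannZetaZeroOrder (ρ : ℂ) : ℝ) * (F ρ).im ^ 2 =
        2⁻¹ * ((riemannZetaZeroOrder (ρ : ℂ) : ℝ) * ‖F ρ‖ ^ 2 -
          (riemannZetaZeroOrder (ρ : ℂ) : ℝ) * ((F ρ).re ^ 2 - (F ρ).im ^ 2)) := by
    intro ρ
    rw [Complex.sq_norm, Complex.normSq_apply]
    ring
  have hI : Summable (fun ρ : ZetaZeros.riemannZetaNontrivialZeros =>
      (riemannZetaZeroOrder (ρ : ℂ) : ℝ) * (F ρ).im ^ 2) := by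
    refine ((hS.sub hD.summable).mul_left 2⁻¹).congr fun ρ => ?_
    exact (hpt ρ).symm
  refine ⟨hI, ?_⟩
  have h2 : ∑' ρ : ZetaZeros.riemannZetaNontrivialZeros, (riemannZetaZeroOrder (ρ : ℂ) : ℝ) * (F ρ).im ^ 2 =
      2⁻¹ * ((∑' ρ : ZetaZeros.riemannZetaNontrivialZeros, (riemannZetaZeroOrder (ρ : ℂ) : ℝ) * ‖F ρ‖ ^ 2) -
        weilGroundEnergy a) := by
    rw [tsum_congr hpt, tsum_mul_left, hS.tsum_sub hD.summable, hD.tsum_eq]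
  rw [h2]
  ring

/-! ### The zero-side tightness criterion -/

/-- Finite zero-side sums of a crux witness tend to zero: if `c_k û_k → ξ` locally uniformly on
the open strip then `Σ_{ρ ∈ S} m(ρ)(c_k û_k(ρ))² → 0` for every finite set `S` of non-trivial zeros
(each zero lies in the open strip and `ξ(ρ) = 0`). [folklore] -/
theorem tendsto_finset_sum_order_mul_sq_renorm {u : ℕ → ℝ → ℂ} {c : ℕ → ℝ}
    (hlim : TendstoLocallyUniformlyOn (fun k s => (c k : ℂ) * weilMellin (u k) s) riemannXi atTop
      {s : ℂ | 0 < s.re ∧ s.re < 1})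
    (S : Finset ZetaZeros.riemannZetaNontrivialZeros) :
    Tendsto (fun k => ∑ ρ ∈ S, (riemannZetaZeroOrder (ρ : ℂ) : ℂ) *
      ((c k : ℂ) * weilMellin (u k) ρ) ^ 2) atTop (𝓝 0) := by
  have h0 : (0 : ℂ) = ∑ ρ ∈ S, (riemannZetaZeroOrder (ρ : ℂ) : ℂ) * (riemannXi ρ) ^ 2 := by
    symm
    refine Finset.sum_eq_zero fun ρ _ => ?_
    rw [riemannXi_eq_zero_of_mem_riemannZetaNontrivialZeros ρ.2]
    ring
  rw [h0]
  refine tendsto_finsetSum _ fun ρ _ => ?_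
  have hρ : (ρ : ℂ) ∈ {s : ℂ | 0 < s.re ∧ s.re < 1} :=
    ⟨ZetaZeros.riemannZetaNontrivialZeros.re_pos ρ.2, ZetaZeros.riemannZetaNontrivialZeros.re_lt_one ρ.2⟩
  exact ((hlim.tendsto_at hρ).pow 2).const_mul _

/-- Tail control: if `‖f‖ = g` termwise with `f, g` summable, then for every finite `S`,
`‖Σ' f‖ ≤ ‖Σ_{S} f‖ + (Σ' g − Σ_{S} g)`. [folklore] -/
theorem zeroSideDefect_norm_tsum_le {ι : Type*} {f : ι → ℂ} {g : ι → ℝ} (hf : Summable f)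
    (hg : Summable g) (hfg : ∀ i, ‖f i‖ = g i) (S : Finset ι) :
    ‖∑' i, f i‖ ≤ ‖∑ i ∈ S, f i‖ + (∑' i, g i - ∑ i ∈ S, g i) := by
  have h1 := hf.sum_add_tsum_compl (s := S)
  have h2 := hg.sum_add_tsum_compl (s := S)
  have hgS : Summable fun x : ((S : Set ι)ᶜ : Set ι) => g x := hg.subtype _
  have hfS : Summable fun x : ((S : Set ι)ᶜ : Set ι) => ‖f x‖ := hgS.congr fun x => (hfg x).symm
  have h3 : ‖∑' x : ((S : Set ι)ᶜ : Set ι), f x‖ ≤ ∑' x : ((S : Set ι)ᶜ : Set ι), g x := by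
    refine (norm_tsum_le_tsum_norm hfS).trans (le_of_eq (tsum_congr fun x => hfg x))
  calc ‖∑' i, f i‖ = ‖∑ i ∈ S, f i + ∑' x : ((S : Set ι)ᶜ : Set ι), f x‖ := by rw [h1]
    _ ≤ ‖∑ i ∈ S, f i‖ + ‖∑' x : ((S : Set ι)ᶜ : Set ι), f x‖ := norm_add_le _ _
    _ ≤ ‖∑ i ∈ S, f i‖ + ∑' x : ((S : Set ι)ᶜ : Set ι), g x := by linarith
    _ = ‖∑ i ∈ S, f i‖ + (∑' i, g i - ∑ i ∈ S, g i) := by rw [← h2]; ring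

/-- **The zero-side tightness criterion (RH-free).**  Let `(a_k, u_k, c_k)` be a REAL EVEN crux
witness with POSITIVE (here: real) constants — windows `a_k → ∞`, real even ground states `u_k`,
`c_k û_k → ξ` locally uniformly on the open critical strip (the normal form of the crux, c6) —
and suppose the renormalised zero samples are ℓ²(m)-TIGHT: for every `η > 0` there is a finite
set `S` of non-trivial zeros with `Σ_ρ m(ρ)‖c_k û_k(ρ)‖² ≤ Σ_{ρ∈S} m(ρ)‖c_k û_k(ρ)‖² + η` for
every `k`.  Then the Riemann Hypothesis holds.  Proof: by the real-even energy identity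
`c_k² ε(a_k) = Σ_ρ m (c_k û_k(ρ))²`; the finite part tends to `Σ_{ρ∈S} m ξ(ρ)² = 0` and the
tail is `≤ η`, so `c_k² ε(a_k) → 0`; if RH failed, `‖c_k‖ → ∞` (`tendsto_norm_atTop_of_not_riemannHypothesis`),
so eventually `|ε(a_k)| ≤ 1`, whence `ε ≥ -1` on `(0, ∞)` (`ε` is antitone and `a_k → ∞`) and RH
follows from `riemannHypothesis_of_weilGroundEnergy_bddBelow` — contradiction. [folklore] -/
theorem riemannHypothesis_of_realEvenCruxWitness_zeroSideTight {a : ℕ → ℝ} {u : ℕ → ℝ → ℂ}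
    {c : ℕ → ℝ} (ha : Tendsto a atTop atTop) (hu : ∀ k, IsWeilGroundState (a k) (u k))
    (hev : ∀ k t, u k (-t) = u k t) (hre : ∀ k t, (u k t).im = 0)
    (hlim : TendstoLocallyUniformlyOn (fun k s => (c k : ℂ) * weilMellin (u k) s) riemannXi atTop
      {s : ℂ | 0 < s.re ∧ s.re < 1})
    (htight : ∀ η : ℝ, 0 < η → ∃ S : Finset ZetaZeros.riemannZetaNontrivialZeros, ∀ k,
      ∑' ρ : ZetaZeros.riemannZetaNontrivialZeros,
          (riemannZetaZeroOrder (ρ : ℂ) : ℝ) * ‖(c k : ℂ) * weilMellin (u k) ρ‖ ^ 2 ≤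
        ∑ ρ ∈ S, (riemannZetaZeroOrder (ρ : ℂ) : ℝ) * ‖(c k : ℂ) * weilMellin (u k) ρ‖ ^ 2 + η) :
    RiemannHypothesis := by
  -- the renormalised zero-side energies `E k = c_k² ε(a_k)`
  set E : ℕ → ℝ := fun k => c k ^ 2 * weilGroundEnergy (a k) with hEdef
  have hm0 : ∀ ρ : ZetaZeros.riemannZetaNontrivialZeros, (0 : ℝ) ≤ riemannZetaZeroOrder (ρ : ℂ) :=
    fun ρ => by
      exact_mod_cast riemannZetaZeroOrder_nonneg (ZetaZeros.riemannZetaNontrivialZeros.ne_one ρ.2)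
  -- Step 1: `E k → 0`
  have hE : Tendsto E atTop (𝓝 0) := by
    rw [Metric.tendsto_atTop]
    intro η hη
    obtain ⟨S, hS⟩ := htight (η / 2) (half_pos hη)
    have hfin := tendsto_finset_sum_order_mul_sq_renorm hlim S
    rw [Metric.tendsto_atTop] at hfin
    obtain ⟨N, hN⟩ := hfin (η / 2) (half_pos hη)
    refine ⟨N, fun k hk => ?_⟩
    have hNk := hN k hk
    rw [dist_zero_right] at hNk ⊢
    -- the terms
    set f : ZetaZeros.riemannZetaNontrivialZeros → ℂ := fun ρ =>
      (riemannZetaZeroOrder (ρ : ℂ) : ℂ) * ((c k : ℂ) * weilMellin (u k) ρ) ^ 2 with hfdef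
    set g : ZetaZeros.riemannZetaNontrivialZeros → ℝ := fun ρ =>
      (riemannZetaZeroOrder (ρ : ℂ) : ℝ) * ‖(c k : ℂ) * weilMellin (u k) ρ‖ ^ 2 with hgdef
    -- `Σ f = E k`
    have hsq : HasSum f ((E k : ℝ) : ℂ) := by
      have h := (hasSum_order_mul_weilMellin_sq (hu k) (hev k) (hre k)).mul_left ((c k : ℂ) ^ 2)
      have hval : (c k : ℂ) ^ 2 * ((weilGroundEnergy (a k) : ℝ) : ℂ) = ((E k : ℝ) : ℂ) := by
        simp only [hEdef]; push_cast; ring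
      rw [← hval]
      refine h.congr_fun fun ρ => ?_
      simp only [hfdef]; ring
    have hfg : ∀ ρ, ‖f ρ‖ = g ρ := fun ρ => by
      simp only [hfdef, hgdef, norm_mul, norm_pow, Complex.norm_intCast, abs_of_nonneg (hm0 ρ)]
    have hgs : Summable g := by
      refine ((summable_order_mul_norm_sq_weilMellin (hu k)).mul_left (c k ^ 2)).congr fun ρ => ?_
      simp only [hgdef, norm_mul, mul_pow, Complex.norm_real, Real.norm_eq_abs, sq_abs]
      ring
    have htail := zeroSideDefect_norm_tsum_le hsq.summable hgs hfg S
    have hSk := hS k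
    have hEq : ‖((E k : ℝ) : ℂ)‖ = |E k| := by
      rw [Complex.norm_real, Real.norm_eq_abs]
    rw [Real.norm_eq_abs, ← hEq, ← hsq.tsum_eq]
    have hNk' : ‖∑ ρ ∈ S, f ρ‖ < η / 2 := hNk
    linarith
  -- Step 2: under `¬RH` the constants blow up, so `ε(a_k) → 0` and `ε` is bounded below
  by_contra hRH
  have hc : Tendsto (fun k => ‖(c k : ℂ)‖) atTop atTop :=
    tendsto_norm_atTop_of_not_riemannHypothesis hRH ha hu hlim
  have hev1 : ∀ᶠ k in atTop, -1 ≤ weilGroundEnergy (a k) := by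
    have h1 : ∀ᶠ k in atTop, 1 ≤ ‖(c k : ℂ)‖ := hc.eventually (eventually_ge_atTop 1)
    have h2 : ∀ᶠ k in atTop, |E k| ≤ 1 := by
      have := (Metric.tendsto_atTop.1 hE) 1 one_pos
      obtain ⟨N, hN⟩ := this
      filter_upwards [eventually_ge_atTop N] with k hk
      have := hN k hk
      rw [dist_zero_right, Real.norm_eq_abs] at this
      exact this.le
    filter_upwards [h1, h2] with k hk1 hk2
    rw [Complex.norm_real, Real.norm_eq_abs] at hk1
    have hc2 : 1 ≤ c k ^ 2 := by nlinarith [sq_abs (c k), abs_nonneg (c k)]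
    have hEk : |c k ^ 2 * weilGroundEnergy (a k)| ≤ 1 := hk2
    rw [abs_mul, abs_of_nonneg (by positivity : (0 : ℝ) ≤ c k ^ 2)] at hEk
    have hε : |weilGroundEnergy (a k)| ≤ 1 := by
      have h3 : |weilGroundEnergy (a k)| ≤ c k ^ 2 * |weilGroundEnergy (a k)| :=
        le_mul_of_one_le_left (abs_nonneg _) hc2
      linarith
    linarith [neg_abs_le (weilGroundEnergy (a k))]
  have hbdd : ∃ L : ℝ, ∀ b : ℝ, 0 < b → L ≤ weilGroundEnergy b := by
    refine ⟨-1, fun b hb => ?_⟩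
    obtain ⟨k, hk1, hk2⟩ := (hev1.and (ha.eventually (eventually_ge_atTop b))).exists
    exact hk1.trans (weilGroundEnergy_anti hb hk2)
  exact hRH (riemannHypothesis_of_weilGroundEnergy_bddBelow hbdd)

end Summit.RiemannHypothesis.RiemannHypothesis.Theorems.GroundStatesConvergeToXi

end
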